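import Summits.BirchSwinnertonDyer.BirchSwinnertonDyer.Theorems.SmallImageMuTransferMuTransferX9LocalTransverse
import Summits.BirchSwinnertonDyer.Rank1Residual.GaloisImage.TransverseLocalPairingVanishing
import Summits.BirchSwinnertonDyer.Rank1Residual.GaloisImage.UnramifiedLocalPairingVanishing
import HarnessLib

/-!
# K6 crux `MuTransferX9` (stmt-BirchSwinnertonDyer-19276), CORE-PLAN S4.3 design (KOLY-MEMO §5.11.B (N3)):
# the local pairing `H¹_tr(K_v, M) × H¹_ur(K_v, M^D) → ℤ/n` is NON-DEGENERATE on both sides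
# (from perfectness of the family, `tr ⊥ tr`, `ur ⊥ ur`, and `H¹ = H¹_ur ⊕ H¹_tr`)

Cell `bsd-smallim`, seat `bsd-smallim-koly` gen 7 (route `SmallImageMuTransfer`, rung K6, leaf
`Rank1Residual.BSDpOnClassX9`). HONEST FRAMING: TOOL theorems of local duality RELATIVE TO A FAMILY
`inv : LocalInvariants K n` (as everywhere in the cell's duality layer — perfectness enters as the
hypothesis `inv.IsPerfect`, supplied in the tree only by the Poitou–Tate facts); no definition, no
named fact, no `sorry`; nothing is booked. Serves the OPEN registered stub `stub_coreX9` of crux 19276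
(skeleton v4 0154dd5daf38efd6) as input (N3) of the DESIGN of record for CORE-PLAN S4.3 (KOLY-MEMO v1.8.7
§5.11.B) and credits nothing toward its closure (`--supports … --as helper`).
PARTITION (D-0054): X9 (A4) × p ∈ {5, 7} — helper; closes NONE.

## Content (generic: `K` a number field, `M` finite discrete killed by `n` (odd) and by `ℓ − 1`,
`v` a finite place with `M` and `M^D` unramified, `χ̄_ℓ` onto on inertia)

* `eq_zero_of_mem_transverse_of_forall_unramified_pairing_eq_zero` — a TRANSVERSE class of `M` pairing
  to zero with every UNRAMIFIED class of `M^D` is zero: it also pairs to zero with every transverse class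
  (x9 `localTatePairingZMod_eq_zero_of_mem_transverseSubgroup`, `n` odd), hence with all of
  `H¹(K_v, M^D) = H¹_ur + H¹_tr` (x9's sup theorem for `M^D`), hence is `0` by perfectness.
* `eq_zero_of_mem_unramified_of_forall_transverse_pairing_eq_zero` — dually, an UNRAMIFIED class of
  `M^D` pairing to zero with every TRANSVERSE class of `M` is zero (`ur ⊥ ur`, x9
  `localTatePairingZMod_eq_zero_of_mem_unramifiedSubgroup`; sup for `M`; perfectness on the other side).
So `H¹_tr(K_v, M) × H¹_ur(K_v, M^D) → ℤ/n` is a perfect pairing of finite groups — the `tr × ur`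
perfectness used in KOLY-MEMO §5.11.B (N3) to make the coefficient family of the local cup product at an
`E`-split prime a UNIT multiple of the Gorenstein family (`…X9PairingUniqueness.lean`).

References: B. Mazur, K. Rubin, Mem. AMS 799 (2004) Prop. 1.3.2 [MazurRubin2004]; K. Rubin, PCMI 18
(2011) Prop. 1.9.5 (4) [Rubin2011]; J. S. Milne, *Arithmetic Duality Theorems* (2006) I Cor. 2.3,
Thm. 2.6 [MilneADT2006].
-/

set_option linter.dupNamespace false
set_option autoImplicit false

noncomputable section

open scoped Classical ContRepresentation

universe u

namespace Summit.BirchSwinnertonDyer.BirchSwinnertonDyer.Rank1Residual.LocalSplitPrime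

open Function Field ValuativeRel NumberField IsDedekindDomain
open Literature.NumberTheory.GaloisRepresentations
open Literature.NumberTheory.GaloisRepresentations.IsNonarchimedeanLocalField
open Literature.NumberTheory.GaloisCohomology
open Summit.BirchSwinnertonDyer.Rank1Residual.GaloisImage

section TransversePerfect

variable {K : Type u} [Field K] [NumberField K] {M : Type u} [AddCommGroup M] [TopologicalSpace M]
  [DiscreteTopology M] [Finite M] (ρ : DiscreteGaloisModule K M) {n : ℕ} (inv : LocalInvariants K n)
  (v : HeightOneSpectrum (𝓞 K)) (ℓ : ℕ) [Fact ℓ.Prime] [NeZero ((ℓ : ℕ) : v.adicCompletion K)]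

/-- **A transverse class pairing to zero with every unramified dual class is zero** (`n` odd, `inv`
perfect; `M`, `M^D` unramified at `v`, `(ℓ−1)M = 0`, `χ̄_ℓ` onto on inertia, `ℓ` the residue
characteristic): the `tr × ur` local Tate pairing is non-degenerate on the transverse side.
[cite: MazurRubin2004, Prop. 1.3.2 (p. 12)] [cite: MilneADT2006, Ch. I, Cor. 2.3] -/
theorem eq_zero_of_mem_transverse_of_forall_unramified_pairing_eq_zero (hn : Odd n)
    (hperf : inv.IsPerfect) (hMn : ∀ m : M, n • m = 0)
    (hchar : ringChar 𝓀[v.adicCompletion K] = ℓ)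
    (hI : ∀ t ∈ absInertia (v.adicCompletion K), ∀ m : M, GaloisRep.toLocal v ρ t m = m)
    (hID : ∀ t ∈ absInertia (v.adicCompletion K), ∀ f : DiscreteGaloisModule.TateDual K M n,
      GaloisRep.toLocal v (ρ.tateDual n) t f = f)
    (hM : ∀ m : M, (ℓ - 1) • m = 0)
    (hχI : ∀ u : (ZMod ℓ)ˣ, ∃ t ∈ absInertia (v.adicCompletion K),
      modPCyclotomicCharacterZMod (v.adicCompletion K) ℓ t = u)
    {a : galoisCohomology (GaloisRep.toLocal v ρ) 1}
    (ha : a ∈ DiscreteGaloisModule.transverseSubgroup (GaloisRep.toLocal v ρ)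
      (CyclotomicField ℓ (v.adicCompletion K)))
    (h0 : ∀ b ∈ DiscreteGaloisModule.unramifiedSubgroup (GaloisRep.toLocal v (ρ.tateDual n)) 1,
      DiscreteGaloisModule.localTatePairingZMod ρ n (Sum.inr v) (inv (Sum.inr v)) a b = 0) :
    a = 0 := by
  classical
  haveI : NeZero n := ⟨hn.pos.ne'⟩
  haveI : Finite (DiscreteGaloisModule.TateDual K M n) :=
    DiscreteGaloisModule.TateDual.finite (K := K) (M := M) n
  -- `a` pairs to zero with every class of `M^D`: decompose into unramified + transverse
  have hMD : ∀ f : DiscreteGaloisModule.TateDual K M n, (ℓ - 1) • f = 0 :=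
    fun f => TransverseCup.nsmul_tateDual_eq_zero n hM f
  have hsup := unramifiedSubgroup_sup_transverseSubgroup_cyclotomicField_eq_top
    (GaloisRep.toLocal v (ρ.tateDual n)) ℓ hchar hID hMD hχI
  have hall : ∀ b : galoisCohomology (GaloisRep.toLocal v (ρ.tateDual n)) 1,
      DiscreteGaloisModule.localTatePairingZMod ρ n (Sum.inr v) (inv (Sum.inr v)) a b = 0 := by
    intro b
    have hb : b ∈ DiscreteGaloisModule.unramifiedSubgroup (GaloisRep.toLocal v (ρ.tateDual n)) 1 ⊔
        DiscreteGaloisModule.transverseSubgroup (GaloisRep.toLocal v (ρ.tateDual n))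
          (CyclotomicField ℓ (v.adicCompletion K)) := by rw [hsup]; trivial
    obtain ⟨b₁, hb₁, b₂, hb₂, rfl⟩ := AddSubgroup.mem_sup.1 hb
    have h2 := TransverseCup.localTatePairingZMod_eq_zero_of_mem_transverseSubgroup ρ n v ℓ hn hI hID
      hχI (inv (Sum.inr v)) ha hb₂
    calc DiscreteGaloisModule.localTatePairingZMod ρ n (Sum.inr v) (inv (Sum.inr v)) a (b₁ + b₂)
        = DiscreteGaloisModule.localTatePairingZMod ρ n (Sum.inr v) (inv (Sum.inr v)) a b₁ +
          DiscreteGaloisModule.localTatePairingZMod ρ n (Sum.inr v) (inv (Sum.inr v)) a b₂ :=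
          AddMonoidHom.map_add _ _ _
      _ = 0 := by rw [h0 b₁ hb₁, h2, add_zero]
  -- perfectness: the adjoint `a ↦ ⟨a, ·⟩` is injective
  have hinj := ((hperf v).2 ρ hMn).1.1
  have hzero : DiscreteGaloisModule.localTatePairingZMod ρ n (Sum.inr v) (inv (Sum.inr v)) a = 0 :=
    AddMonoidHom.ext fun b => hall b
  exact hinj (hzero.trans (AddMonoidHom.map_zero _).symm)

/-- **An unramified dual class pairing to zero with every transverse class is zero** (`inv` perfect;
`M`, `M^D` unramified at `v`, `(ℓ−1)M = 0`, `χ̄_ℓ` onto on inertia): the `tr × ur` local Tate pairing is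
non-degenerate on the unramified side. [cite: MazurRubin2004, Prop. 1.3.2 (p. 12)]
[cite: MilneADT2006, Ch. I, Thm. 2.6] -/
theorem eq_zero_of_mem_unramified_of_forall_transverse_pairing_eq_zero [NeZero n]
    (hperf : inv.IsPerfect) (hMn : ∀ m : M, n • m = 0)
    (hchar : ringChar 𝓀[v.adicCompletion K] = ℓ)
    (hI : ∀ t ∈ absInertia (v.adicCompletion K), ∀ m : M, GaloisRep.toLocal v ρ t m = m)
    (hID : ∀ t ∈ absInertia (v.adicCompletion K), ∀ f : DiscreteGaloisModule.TateDual K M n,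
      GaloisRep.toLocal v (ρ.tateDual n) t f = f)
    (hM : ∀ m : M, (ℓ - 1) • m = 0)
    (hχI : ∀ u : (ZMod ℓ)ˣ, ∃ t ∈ absInertia (v.adicCompletion K),
      modPCyclotomicCharacterZMod (v.adicCompletion K) ℓ t = u)
    {b : galoisCohomology (GaloisRep.toLocal v (ρ.tateDual n)) 1}
    (hb : b ∈ DiscreteGaloisModule.unramifiedSubgroup (GaloisRep.toLocal v (ρ.tateDual n)) 1)
    (h0 : ∀ a ∈ DiscreteGaloisModule.transverseSubgroup (GaloisRep.toLocal v ρ)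
      (CyclotomicField ℓ (v.adicCompletion K)),
      DiscreteGaloisModule.localTatePairingZMod ρ n (Sum.inr v) (inv (Sum.inr v)) a b = 0) :
    b = 0 := by
  have hsup := unramifiedSubgroup_sup_transverseSubgroup_cyclotomicField_eq_top
    (GaloisRep.toLocal v ρ) ℓ hchar hI hM hχI
  have hall : ∀ a : galoisCohomology (GaloisRep.toLocal v ρ) 1,
      DiscreteGaloisModule.localTatePairingZMod ρ n (Sum.inr v) (inv (Sum.inr v)) a b = 0 := by
    intro a
    have ha : a ∈ DiscreteGaloisModule.unramifiedSubgroup (GaloisRep.toLocal v ρ) 1 ⊔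
        DiscreteGaloisModule.transverseSubgroup (GaloisRep.toLocal v ρ)
          (CyclotomicField ℓ (v.adicCompletion K)) := by rw [hsup]; trivial
    obtain ⟨a₁, ha₁, a₂, ha₂, rfl⟩ := AddSubgroup.mem_sup.1 ha
    have h1 := UnramifiedCup.localTatePairingZMod_eq_zero_of_mem_unramifiedSubgroup ρ n v hI hID
      (inv (Sum.inr v)) ha₁ hb
    set L := DiscreteGaloisModule.localTatePairingZMod ρ n (Sum.inr v) (inv (Sum.inr v)) with hL
    calc L (a₁ + a₂) b = L a₁ b + L a₂ b :=
          (congrArg (fun φ => φ b) (L.map_add a₁ a₂)).trans (AddMonoidHom.add_apply _ _ _)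
      _ = 0 := by rw [h1, h0 a₂ ha₂, add_zero]
  -- perfectness on the other side: `b ↦ ⟨·, b⟩` is injective
  classical
  have hinj := ((hperf v).2 ρ hMn).2.1
  have hzero : (DiscreteGaloisModule.localTatePairingZMod ρ n (Sum.inr v) (inv (Sum.inr v))).flip b = 0 :=
    AddMonoidHom.ext fun a => hall a
  exact hinj (hzero.trans (AddMonoidHom.map_zero _).symm)

end TransversePerfect

end Summit.BirchSwinnertonDyer.BirchSwinnertonDyer.Rank1Residual.LocalSplitPrime

end
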